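import Summits.ValiantsHypothesis.ValiantsHypothesis.Theorems.KPlusLogSqLawValuativeDoorSweep

/-!
# LINE `valuative_door` (crux `WeakLifting`, stmt-ValiantsHypothesis-19561) — OFF THREE-TERM PROGRESSIONS THE WIDTH-TWO ROW IS LINEAR:
# `Dom(a c − b²) ⊆ Dom(a c) ∪ Dom(b²)` when the tied progression binomials are cancellation-free, hence THE SIDON ROW `npEdges ≤ 3K − 4`

HONEST FRAMING.  Helper (cell `pub-symmetroid`, seat val-sym-lift-p1 g24, 2026-08-29; `--supports 19561 --as helper`).  Width two, ALL `K`,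
every field, every residue characteristic, on the raw `domCount` predicate («`E` strictly dominates every other support exponent at some
radius `r > 0`»).  The determinant of a `2 × 2` lacunary pencil is `f = a·d − b·c` with `a, b, c, d` the four entry polynomials
(`Matrix.det_fin_two`).  SWEEP PRINCIPLE (§2–§3): away from the finitely many TIE RADII of `a, b, c, d` (`tieRadii_finite`) each of them has a
unique leading exponent `X, Y, Z, W` (`exists_lead_of_not_mem_tieRadii`), and then (`dominant_sub_mul_split`) the determinant is either
NOT sharp at that radius or sharp with leading exponent `X + Y` (the lead of `a·d`, landed `dominant_mul`) or `Z + W` (the lead of `b·c`) —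
PROVIDED that in the tied case `X + Y = Z + W`, `v(a_X d_Y) = v(b_Z c_W)` the binomial `a_X d_Y − b_Z c_W` does not cancel
(`v(a_X d_Y − b_Z c_W) = max`).  Since a dominant exponent stays dominant on a neighbourhood (`exists_dominant_radius_not_mem`), every
dominant exponent of `f` is realised at a radius off the tie radii, so `Dom(f) ⊆ Dom(a d) ∪ Dom(b c)` and, by the landed product count
`card_dominant_mul_le` (g21), `#Dom(f) ≤ #Dom(a d) + #Dom(b c)` (`card_dominant_sub_mul_le`; general letters: `≤ 4K − 2`), and
`#Dom(b²) ≤ #Dom(b) ≤ K` (`card_dominant_sq_le`).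
SYMMETRIC LETTERS (§5): `b = c`, so `Z = W` and the only ties are THREE-TERM PROGRESSIONS `d_x + d_y = 2 d_z` of the support:
`valProgressionFree_unfolded` — if every AP-binomial `a_x c_y − b_z²` is cancellation-free then the dominant exponents are the DIAGONAL
`2 d_l` (at most `K`) and OFF-DIAGONAL sums `x + y`, `x ≠ y`, whose pairs form a CHAIN (leads move up with the radius) inside
`(E ∖ max) × (E ∖ min)`, at most `2K − 3` by the landed `card_chain_le` (`card_dominant_symm_le`): `npEdges ≤ 3K − 4` — EXACTLY THE SIDON ROW
(✓ `valSidonTwo_unfolded`, sharp by ✓ `valSidonTwo_sharp_unfolded`) on every support; in particular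
(`valAPFreeSupport_unfolded`) on supports WITHOUT three-term progressions it suffices that each letter's own determinant is cancellation-free
(`v(a_l c_l − b_l²) = max(v(a_l c_l), v(b_l²))`).  READING: the Sidon row is `3K − 4` exact (✓ `valSidonTwo_unfolded`, `valSidonTwo_sharp_unfolded`)
and OFF Sidon supports `v(2,5) ≥ 13 > 11` (✓ `valNonSidonFive_unfolded`, support `(0,3,4,8,14)` with the progression `0 + 8 = 4 + 4`); this file
says that ANY growth of the unrestricted width-two row beyond the Sidon value `3K − 4` must come from three-term progressions of the support carrying an exact
leading cancellation `a_x c_y ≡ b_z²` (or a valuatively singular letter, `x = y = z`) — four-term coincidences `d_x + d_y = d_z + d_w` with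
four distinct letters never tie a symmetric determinant at a sharp radius.  A LINEAR law for the unrestricted row is not claimed (the companion
file `…ValuativeDoorFGPlusOne` records why it is open-problem-hard).  Nothing here is a stub of the line or closes anything; no bearing on
vW / vB, `TropicalB`, `MatrixDescartes` (18050) or VP ≠ VNP.  [elementary; ultrametric sweep]
-/

set_option linter.dupNamespace false
set_option autoImplicit false

namespace Summit.ValiantsHypothesis.ValiantsHypothesis.Theorems.KPlusLogSqLaw.ValDoor

open Polynomial Finset
open scoped BigOperators Classical

variable {F : Type*} [Field F]

/-! ## §5 Width-two pencils -/

/-- coefficients of a letter sum `Σ_l g_l X^{d_l}` on an injective support. [bookkeeping] -/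
theorem coeff_letterSum {K : ℕ} (d : Fin K → ℕ) (g : Fin K → F) (E : ℕ) :
    (∑ l, C (g l) * (X : F[X]) ^ d l).coeff E = ∑ l ∈ (univ : Finset (Fin K)).filter (fun l => d l = E), g l := by
  rw [Polynomial.finsetSum_coeff, Finset.sum_filter]
  refine Finset.sum_congr rfl fun l _ => ?_
  rw [Polynomial.coeff_C_mul_X_pow]
  by_cases h : d l = E
  · rw [if_pos h, if_pos h.symm]
  · rw [if_neg h, if_neg (fun h' => h h'.symm)]

/-- on an injective support the coefficient at `d l` is the letter `g l`. [bookkeeping] -/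
theorem coeff_letterSum_of_injective {K : ℕ} (d : Fin K → ℕ) (hd : Function.Injective d) (g : Fin K → F) (l : Fin K) :
    (∑ l, C (g l) * (X : F[X]) ^ d l).coeff (d l) = g l := by
  rw [coeff_letterSum]
  have hfl : (univ : Finset (Fin K)).filter (fun l' => d l' = d l) = {l} := by
    ext l'
    simp only [Finset.mem_filter, Finset.mem_univ, true_and, Finset.mem_singleton]
    exact ⟨fun h => hd h, fun h => by rw [h]⟩
  rw [hfl, Finset.sum_singleton]

/-- a nonzero coefficient of a letter sum sits at some letter exponent. [bookkeeping] -/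
theorem exists_letter_of_coeff_ne_zero {K : ℕ} (d : Fin K → ℕ) (g : Fin K → F) {E : ℕ}
    (hE : (∑ l, C (g l) * (X : F[X]) ^ d l).coeff E ≠ 0) : ∃ l : Fin K, d l = E := by
  by_contra h
  push Not at h
  apply hE
  rw [coeff_letterSum]
  refine Finset.sum_eq_zero fun l hl => ?_
  exact absurd (Finset.mem_filter.1 hl).2 (h l)

/-- a letter sum with `K` letters has at most `K` dominant exponents (at most `K` support exponents). [bookkeeping] -/
theorem card_dominant_letterSum_le {K : ℕ} (v : AbsoluteValue F ℝ) (d : Fin K → ℕ) (g : Fin K → F) :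
    ((∑ l, C (g l) * (X : F[X]) ^ d l).support.filter fun E => ∃ r : ℝ, 0 < r ∧
        ∀ E' ∈ (∑ l, C (g l) * (X : F[X]) ^ d l).support, E' ≠ E →
          v ((∑ l, C (g l) * (X : F[X]) ^ d l).coeff E') * r ^ E' < v ((∑ l, C (g l) * (X : F[X]) ^ d l).coeff E) * r ^ E).card
      ≤ K := by
  refine (Finset.card_filter_le _ _).trans ?_
  have hsub : (∑ l, C (g l) * (X : F[X]) ^ d l).support ⊆ (univ : Finset (Fin K)).image d := by
    intro E hE
    obtain ⟨l, hl⟩ := exists_letter_of_coeff_ne_zero d g (Polynomial.mem_support_iff.1 hE)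
    exact Finset.mem_image.2 ⟨l, Finset.mem_univ _, hl⟩
  calc _ ≤ ((univ : Finset (Fin K)).image d).card := Finset.card_le_card hsub
    _ ≤ (univ : Finset (Fin K)).card := Finset.card_image_le
    _ = K := by rw [Finset.card_univ, Fintype.card_fin]

/-- **the dominant exponents of a square are the doubled dominant exponents**: `#Dom(b·b) ≤ #Dom(b)` (move the radius off the tie
radii of `b`; there `b` has a unique lead `Z` and `2Z` is the dominant exponent of `b·b`, landed `dominant_mul`). [elementary] -/
theorem card_dominant_sq_le (v : AbsoluteValue F ℝ) (hv : IsNonarchimedean v) (b : F[X]) :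
    ((b * b).support.filter fun E => ∃ r : ℝ, 0 < r ∧ ∀ E' ∈ (b * b).support, E' ≠ E →
        v ((b * b).coeff E') * r ^ E' < v ((b * b).coeff E) * r ^ E).card
      ≤ (b.support.filter fun E => ∃ r : ℝ, 0 < r ∧ ∀ E' ∈ b.support, E' ≠ E →
        v (b.coeff E') * r ^ E' < v (b.coeff E) * r ^ E).card := by
  by_cases hb : b = 0
  · simp [hb]
  set Dbb := (b * b).support.filter fun E => ∃ r : ℝ, 0 < r ∧ ∀ E' ∈ (b * b).support, E' ≠ E →
      v ((b * b).coeff E') * r ^ E' < v ((b * b).coeff E) * r ^ E with hDbb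
  set Db := b.support.filter fun E => ∃ r : ℝ, 0 < r ∧ ∀ E' ∈ b.support, E' ≠ E →
      v (b.coeff E') * r ^ E' < v (b.coeff E) * r ^ E with hDb
  -- every `G ∈ Dbb` is `2 Z` for some `Z ∈ Db`
  have hhalf : ∀ G ∈ Dbb, ∃ Z ∈ Db, G = Z + Z := by
    intro G hG
    obtain ⟨hGsupp, r₀, hr₀, hdom⟩ := Finset.mem_filter.1 hG
    obtain ⟨r, hr, hrN, hdomr⟩ := exists_dominant_radius_not_mem v (b * b) hr₀ hdom (tieRadii_finite v b)
    obtain ⟨Z, hbZ, hZ⟩ := exists_lead_of_not_mem_tieRadii v b hb hr hrN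
    obtain ⟨-, hbb⟩ := dominant_mul v hv b b hr hbZ hbZ hZ hZ
    have hGZ : G = Z + Z := by
      by_contra hne
      have h1 := hbb G hne
      by_cases hZs : Z + Z ∈ (b * b).support
      · exact lt_asymm h1 (hdomr (Z + Z) hZs (Ne.symm hne))
      · rw [Polynomial.notMem_support_iff.1 hZs, map_zero, zero_mul] at h1
        exact absurd h1 (not_lt.2 (mul_nonneg (v.nonneg _) (pow_nonneg hr.le _)))
    refine ⟨Z, Finset.mem_filter.2 ⟨Polynomial.mem_support_iff.2 hbZ, r, hr, fun E' _ hne => hZ E' hne⟩, hGZ⟩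
  -- the halving map is injective
  calc Dbb.card ≤ (Db.image fun Z => Z + Z).card := Finset.card_le_card fun G hG => by
          obtain ⟨Z, hZ, hGZ⟩ := hhalf G hG
          exact Finset.mem_image.2 ⟨Z, hZ, hGZ.symm⟩
    _ ≤ Db.card := Finset.card_image_le

/-! ## §6 Symmetric letters: the progression-free row is the Sidon row `3K − 4` -/

/-- **split data for `a c − b²`**: every dominant exponent of `a·c − b·b` (all three nonzero, tied progression binomials cancellation-free)
is realised at a radius where `a, b, c` have unique leads `x, z, y`, and equals `x + y` or `z + z`. [sweep + uniqueness of the lead] -/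
theorem exists_leads_of_dominant_symm (v : AbsoluteValue F ℝ) (hv : IsNonarchimedean v) (a b c : F[X])
    (ha : a ≠ 0) (hb : b ≠ 0) (hc : c ≠ 0)
    (hAP : ∀ (r : ℝ) (X Y Z : ℕ), 0 < r → a.coeff X ≠ 0 → c.coeff Y ≠ 0 → b.coeff Z ≠ 0 →
      (∀ E' : ℕ, E' ≠ X → v (a.coeff E') * r ^ E' < v (a.coeff X) * r ^ X) →
      (∀ E' : ℕ, E' ≠ Y → v (c.coeff E') * r ^ E' < v (c.coeff Y) * r ^ Y) →
      (∀ E' : ℕ, E' ≠ Z → v (b.coeff E') * r ^ E' < v (b.coeff Z) * r ^ Z) →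
      X + Y = Z + Z →
      v (a.coeff X * c.coeff Y - b.coeff Z * b.coeff Z) = max (v (a.coeff X * c.coeff Y)) (v (b.coeff Z * b.coeff Z)))
    {G : ℕ} (hG : G ∈ ((a * c - b * b).support.filter fun E => ∃ r : ℝ, 0 < r ∧ ∀ E' ∈ (a * c - b * b).support, E' ≠ E →
        v ((a * c - b * b).coeff E') * r ^ E' < v ((a * c - b * b).coeff E) * r ^ E)) :
    ∃ (r : ℝ) (x y z : ℕ), 0 < r ∧ a.coeff x ≠ 0 ∧ c.coeff y ≠ 0 ∧ b.coeff z ≠ 0 ∧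
      (∀ E' : ℕ, E' ≠ x → v (a.coeff E') * r ^ E' < v (a.coeff x) * r ^ x) ∧
      (∀ E' : ℕ, E' ≠ y → v (c.coeff E') * r ^ E' < v (c.coeff y) * r ^ y) ∧
      (∀ E' : ℕ, E' ≠ G → v ((a * c - b * b).coeff E') * r ^ E' < v ((a * c - b * b).coeff G) * r ^ G) ∧
      (G = x + y ∨ G = z + z) := by
  set f : F[X] := a * c - b * b with hf
  obtain ⟨hGsupp, r₀, hr₀, hdom⟩ := Finset.mem_filter.1 hG
  set T : F[X] → Set ℝ := fun h => {r : ℝ | 0 < r ∧ ∃ E ∈ h.support, ∃ E' ∈ h.support, E < E' ∧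
      v (h.coeff E) * r ^ E = v (h.coeff E') * r ^ E'} with hT
  have hN : (T a ∪ T c ∪ T b).Finite := ((tieRadii_finite v a).union (tieRadii_finite v c)).union (tieRadii_finite v b)
  obtain ⟨r, hr, hrN, hdomr⟩ := exists_dominant_radius_not_mem v f hr₀ hdom hN
  simp only [Set.mem_union, not_or] at hrN
  obtain ⟨⟨hra, hrc⟩, hrb⟩ := hrN
  obtain ⟨x, hax, hx⟩ := exists_lead_of_not_mem_tieRadii v a ha hr hra
  obtain ⟨y, hcy, hy⟩ := exists_lead_of_not_mem_tieRadii v c hc hr hrc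
  obtain ⟨z, hbz, hz⟩ := exists_lead_of_not_mem_tieRadii v b hb hr hrb
  have hfG : f.coeff G ≠ 0 := Polynomial.mem_support_iff.1 hGsupp
  have hGall : ∀ E' : ℕ, E' ≠ G → v (f.coeff E') * r ^ E' < v (f.coeff G) * r ^ G := by
    intro E' hne
    by_cases hE' : E' ∈ f.support
    · exact hdomr E' hE' hne
    · rw [Polynomial.notMem_support_iff.1 hE', map_zero, zero_mul]
      exact mul_pos (v.pos hfG) (pow_pos hr G)
  -- uniqueness of a strictly dominating exponent at the radius `r`
  have huniq : ∀ (h : F[X]) (E E₀ : ℕ), (∀ E', E' ≠ E → v (h.coeff E') * r ^ E' < v (h.coeff E) * r ^ E) →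
      (∀ E', E' ≠ E₀ → v (h.coeff E') * r ^ E' < v (h.coeff E₀) * r ^ E₀) → E = E₀ := by
    intro h E E₀ hE hE₀
    by_contra hne
    exact lt_asymm (hE E₀ (Ne.symm hne)) (hE₀ E hne)
  refine ⟨r, x, y, z, hr, hax, hcy, hbz, hx, hy, hGall, ?_⟩
  rcases dominant_sub_mul_split v hv a c b b hr hax hcy hbz hbz hx hy hz hz
      (hAP r x y z hr hax hcy hbz hx hy hz) hGall with h | h
  · exact Or.inl (huniq _ _ _ h (dominant_mul v hv a c hr hax hcy hx hy).2)
  · exact Or.inr (huniq _ _ _ h (dominant_mul v hv b b hr hbz hbz hz hz).2)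

/-- **THE PROGRESSION-FREE COUNT `(2K − 3) + K`** for `f = a c − b²` with `a, b, c` letter sums on an injective `K`-letter support and
the tied progression binomials cancellation-free: the dominant exponents split into DIAGONAL ones `2 d_l` (at most `K`) and OFF-DIAGONAL
ones `x + y`, `x ≠ y`, whose pairs `{x, y}` form a chain for the product order (leads move up with the radius, landed `dominantAt_mono`), so
the landed `card_chain_le` on `(E ∖ max) × (E ∖ min)` bounds them by `2K − 3` — the Sidon count, on every support. [sweep + chain] -/
theorem card_dominant_symm_le (v : AbsoluteValue F ℝ) (hv : IsNonarchimedean v) {K : ℕ} (d : Fin K → ℕ)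
    (hd : Function.Injective d) (α β γ : Fin K → F)
    (hfree : ∀ l₁ l₂ l₃ : Fin K, d l₁ + d l₂ = d l₃ + d l₃ →
      v (α l₁ * γ l₂ - β l₃ * β l₃) = max (v (α l₁ * γ l₂)) (v (β l₃ * β l₃))) :
    (((∑ l, C (α l) * (X : F[X]) ^ d l) * (∑ l, C (γ l) * (X : F[X]) ^ d l)
        - (∑ l, C (β l) * (X : F[X]) ^ d l) * (∑ l, C (β l) * (X : F[X]) ^ d l)).support.filter fun E =>
        ∃ r : ℝ, 0 < r ∧ ∀ E' ∈ ((∑ l, C (α l) * (X : F[X]) ^ d l) * (∑ l, C (γ l) * (X : F[X]) ^ d l)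
            - (∑ l, C (β l) * (X : F[X]) ^ d l) * (∑ l, C (β l) * (X : F[X]) ^ d l)).support, E' ≠ E →
          v (((∑ l, C (α l) * (X : F[X]) ^ d l) * (∑ l, C (γ l) * (X : F[X]) ^ d l)
              - (∑ l, C (β l) * (X : F[X]) ^ d l) * (∑ l, C (β l) * (X : F[X]) ^ d l)).coeff E') * r ^ E'
            < v (((∑ l, C (α l) * (X : F[X]) ^ d l) * (∑ l, C (γ l) * (X : F[X]) ^ d l)
              - (∑ l, C (β l) * (X : F[X]) ^ d l) * (∑ l, C (β l) * (X : F[X]) ^ d l)).coeff E) * r ^ E).card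
      ≤ (2 * K - 3) + K := by
  set a : F[X] := ∑ l, C (α l) * X ^ d l with ha
  set c : F[X] := ∑ l, C (γ l) * X ^ d l with hc
  set b : F[X] := ∑ l, C (β l) * X ^ d l with hb
  set f : F[X] := a * c - b * b with hf
  set Df := f.support.filter fun E => ∃ r : ℝ, 0 < r ∧ ∀ E' ∈ f.support, E' ≠ E →
      v (f.coeff E') * r ^ E' < v (f.coeff E) * r ^ E with hDf
  set E : Finset ℕ := (univ : Finset (Fin K)).image d with hE
  have hEcard : E.card ≤ K := Finset.card_image_le.trans (by rw [Finset.card_univ, Fintype.card_fin])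
  have hDa := card_dominant_letterSum_le v d α
  have hDb := card_dominant_letterSum_le v d β
  have hDc := card_dominant_letterSum_le v d γ
  rw [← ha] at hDa
  rw [← hb] at hDb
  rw [← hc] at hDc
  -- degenerate cases
  by_cases hb0 : b = 0
  · have h0 : f = a * c := by rw [hf, hb0, mul_zero, sub_zero]
    have h1 := card_dominant_mul_le v hv a c
    rw [hDf, h0]
    omega
  by_cases hac0 : a = 0 ∨ c = 0
  · have h0 : a * c = 0 := by rcases hac0 with h | h <;> simp [h]
    have h1 := card_dominant_sq_le v hv b
    rw [hDf, hf, h0, zero_sub, dominant_filter_neg]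
    omega
  push Not at hac0
  obtain ⟨ha0, hc0⟩ := hac0
  -- the r-local hypothesis from the letters
  have hAP : ∀ (r : ℝ) (X Y Z : ℕ), 0 < r → a.coeff X ≠ 0 → c.coeff Y ≠ 0 → b.coeff Z ≠ 0 →
      (∀ E' : ℕ, E' ≠ X → v (a.coeff E') * r ^ E' < v (a.coeff X) * r ^ X) →
      (∀ E' : ℕ, E' ≠ Y → v (c.coeff E') * r ^ E' < v (c.coeff Y) * r ^ Y) →
      (∀ E' : ℕ, E' ≠ Z → v (b.coeff E') * r ^ E' < v (b.coeff Z) * r ^ Z) →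
      X + Y = Z + Z →
      v (a.coeff X * c.coeff Y - b.coeff Z * b.coeff Z) = max (v (a.coeff X * c.coeff Y)) (v (b.coeff Z * b.coeff Z)) := by
    intro r X Y Z _ haX hcY hbZ _ _ _ hS
    obtain ⟨l₁, rfl⟩ := exists_letter_of_coeff_ne_zero d _ haX
    obtain ⟨l₂, rfl⟩ := exists_letter_of_coeff_ne_zero d _ hcY
    obtain ⟨l₃, rfl⟩ := exists_letter_of_coeff_ne_zero d _ hbZ
    simp only [ha, hc, hb, coeff_letterSum_of_injective d hd]
    exact hfree l₁ l₂ l₃ hS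
  -- choose leads for every dominant exponent
  choose! rad lx ly zz hrad hax hcy hbz hx hy hGall hsplit using
    fun G (hG : G ∈ Df) => exists_leads_of_dominant_symm v hv a b c ha0 hb0 hc0 hAP hG
  -- diagonal and off-diagonal dominant exponents
  set Ddiag := Df.filter fun G => G = zz G + zz G ∨ (lx G) = (ly G) with hDdiag
  set Doff := Df.filter fun G => G = (lx G) + (ly G) ∧ (lx G) ≠ (ly G) with hDoff
  have hcover : Df ⊆ Doff ∪ Ddiag := by
    intro G hG
    rcases hsplit G hG with h | h
    · by_cases hxy : (lx G) = (ly G)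
      · exact Finset.mem_union_right _ (Finset.mem_filter.2 ⟨hG, Or.inr hxy⟩)
      · exact Finset.mem_union_left _ (Finset.mem_filter.2 ⟨hG, h, hxy⟩)
    · exact Finset.mem_union_right _ (Finset.mem_filter.2 ⟨hG, Or.inl h⟩)
  -- support exponents are letter exponents
  have hmemE : ∀ (g : Fin K → F) (x : ℕ), (∑ l, C (g l) * (X : F[X]) ^ d l).coeff x ≠ 0 → x ∈ E := by
    intro g x hx
    obtain ⟨l, hl⟩ := exists_letter_of_coeff_ne_zero d g hx
    exact Finset.mem_image.2 ⟨l, Finset.mem_univ _, hl⟩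
  -- the diagonal: at most `K`
  have hdiag : Ddiag.card ≤ K := by
    refine le_trans (Finset.card_le_card (fun G hG => ?_)) ((Finset.card_image_le (s := E) (f := fun x => x + x)).trans hEcard)
    obtain ⟨hGD, hG⟩ := Finset.mem_filter.1 hG
    rw [Finset.mem_image]
    rcases hG with h | h
    · exact ⟨zz G, hmemE β _ (hbz G hGD), h.symm⟩
    · rcases hsplit G hGD with h2 | h2
      · exact ⟨(lx G), hmemE α _ (hax G hGD), ((congrArg (fun t => (lx G) + t) h.symm).symm.trans h2.symm)⟩
      · exact ⟨zz G, hmemE β _ (hbz G hGD), h2.symm⟩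
  -- the off-diagonal pairs form a chain in `(E ∖ max) × (E ∖ min)`
  have hoff : Doff.card ≤ 2 * K - 3 := by
    by_cases hEne : E.Nonempty
    swap
    · -- no letters: nothing is dominant
      have hDoff0 : Doff = ∅ := by
        rw [Finset.eq_empty_iff_forall_notMem]
        intro G hG
        obtain ⟨hGD, -, -⟩ := Finset.mem_filter.1 hG
        exact hEne ⟨_, hmemE α _ (hax G hGD)⟩
      rw [hDoff0, Finset.card_empty]
      exact Nat.zero_le _
    set φ : ℕ → ℕ × ℕ := fun G => (min (lx G) (ly G), max (lx G) (ly G)) with hφ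
    have hinj : Set.InjOn φ (Doff : Set ℕ) := by
      intro G hG G' hG' h
      obtain ⟨-, hGs, -⟩ := Finset.mem_filter.1 (Finset.mem_coe.1 hG)
      obtain ⟨-, hG's, -⟩ := Finset.mem_filter.1 (Finset.mem_coe.1 hG')
      have h1 : min (lx G) (ly G) + max (lx G) (ly G) = min (lx G') (ly G') + max (lx G') (ly G') := by
        have := congrArg (fun q : ℕ × ℕ => q.1 + q.2) h
        simpa [hφ] using this
      rw [min_add_max, min_add_max] at h1
      rw [hGs, hG's, h1]
    set A := E.erase (E.max' hEne) with hA
    set B := E.erase (E.min' hEne) with hB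
    have hmem : ∀ q ∈ Doff.image φ, q.1 ∈ A ∧ q.2 ∈ B := by
      intro q hq
      obtain ⟨G, hG, rfl⟩ := Finset.mem_image.1 hq
      obtain ⟨hGD, -, hne⟩ := Finset.mem_filter.1 hG
      have h1 : (lx G) ∈ E := hmemE α _ (hax G hGD)
      have h2 : (ly G) ∈ E := hmemE γ _ (hcy G hGD)
      have hminE : min (lx G) (ly G) ∈ E := by rcases min_choice (lx G) (ly G) with h | h <;> rw [h] <;> assumption
      have hmaxE : max (lx G) (ly G) ∈ E := by rcases max_choice (lx G) (ly G) with h | h <;> rw [h] <;> assumption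
      have hlt : min (lx G) (ly G) < max (lx G) (ly G) := min_lt_max.2 hne
      refine ⟨Finset.mem_erase.2 ⟨?_, hminE⟩, Finset.mem_erase.2 ⟨?_, hmaxE⟩⟩
      · exact (hlt.trans_le (Finset.le_max' E _ hmaxE)).ne
      · exact ((Finset.min'_le E _ hminE).trans_lt hlt).ne'
    have hchain : ∀ q ∈ Doff.image φ, ∀ q' ∈ Doff.image φ, (q.1 ≤ q'.1 ∧ q.2 ≤ q'.2) ∨ (q'.1 ≤ q.1 ∧ q'.2 ≤ q.2) := by
      intro q hq q' hq'
      obtain ⟨G, hG, rfl⟩ := Finset.mem_image.1 hq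
      obtain ⟨G', hG', rfl⟩ := Finset.mem_image.1 hq'
      have hGD : G ∈ Df := (Finset.mem_filter.1 hG).1
      have hG'D : G' ∈ Df := (Finset.mem_filter.1 hG').1
      have mono : ∀ {G₁ G₂ : ℕ}, G₁ ∈ Df → G₂ ∈ Df → rad G₁ < rad G₂ →
          (φ G₁).1 ≤ (φ G₂).1 ∧ (φ G₁).2 ≤ (φ G₂).2 := by
        intro G₁ G₂ h₁ h₂ hlt
        have m1 : (lx G₁) ≤ (lx G₂) := dominantAt_mono v a (hrad G₁ h₁) hlt (hx G₁ h₁) (hx G₂ h₂)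
        have m2 : (ly G₁) ≤ (ly G₂) := dominantAt_mono v c (hrad G₁ h₁) hlt (hy G₁ h₁) (hy G₂ h₂)
        exact ⟨min_le_min m1 m2, max_le_max m1 m2⟩
      rcases lt_trichotomy (rad G) (rad G') with h | h | h
      · exact Or.inl (mono hGD hG'D h)
      · -- same radius: same leads
        left
        have e1 : (lx G) = (lx G') := by
          by_contra hne
          have u1 := hx G hGD (lx G') (fun h' => hne h'.symm)
          have u2 := hx G' hG'D (lx G) hne
          rw [h] at u1
          exact lt_asymm u1 u2
        have e2 : (ly G) = (ly G') := by
          by_contra hne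
          have u1 := hy G hGD (ly G') (fun h' => hne h'.symm)
          have u2 := hy G' hG'D (ly G) hne
          rw [h] at u1
          exact lt_asymm u1 u2
        simp only [hφ]
        rw [e1, e2]
        exact ⟨le_rfl, le_rfl⟩
      · exact Or.inr (mono hG'D hGD h)
    have hcard := card_chain_le A B (Doff.image φ) hmem hchain
    have hAc : A.card ≤ K - 1 := by
      rw [hA, Finset.card_erase_of_mem (Finset.max'_mem E hEne)]
      exact Nat.sub_le_sub_right hEcard 1
    have hBc : B.card ≤ K - 1 := by
      rw [hB, Finset.card_erase_of_mem (Finset.min'_mem E hEne)]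
      exact Nat.sub_le_sub_right hEcard 1
    calc Doff.card = (Doff.image φ).card := (Finset.card_image_of_injOn hinj).symm
      _ ≤ A.card + B.card - 1 := hcard
      _ ≤ 2 * K - 3 := by omega
  calc Df.card ≤ (Doff ∪ Ddiag).card := Finset.card_le_card hcover
    _ ≤ Doff.card + Ddiag.card := Finset.card_union_le _ _
    _ ≤ (2 * K - 3) + K := Nat.add_le_add hoff hdiag

/-- **THE PROGRESSION-FREE ROW IS THE SIDON ROW `3K − 4` (all `K`, every non-archimedean field), UNFOLDED.**  For a symmetric pencil
`Σ_l X^{d_l} S_l` on an injective support (`a_l = S_l 0 0`, `b_l = S_l 0 1`, `c_l = S_l 1 1`): if for every three-term progression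
`d_{l₁} + d_{l₂} = 2 d_{l₃}` of the support (the letter case `l₁ = l₂ = l₃` included) the AP-binomial `a_{l₁} c_{l₂} − b_{l₃}²` is
cancellation-free, then at most `(2K − 3) + K` exponents of the determinant are dominant: `npEdges ≤ 3K − 4`, the SIDON value
(✓ `valSidonTwo_unfolded`, sharp by ✓ `valSidonTwo_sharp_unfolded`) on EVERY support. [`card_dominant_symm_le`] -/
theorem valProgressionFree_unfolded :
    ∀ (F : Type) [Field F] (v : AbsoluteValue F ℝ), IsNonarchimedean v →
      ∀ (K : ℕ) (d : Fin K → ℕ) (S : Fin K → Matrix (Fin 2) (Fin 2) F), (∀ l, (S l).IsSymm) → Function.Injective d →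
        (∀ l₁ l₂ l₃ : Fin K, d l₁ + d l₂ = d l₃ + d l₃ →
          v (S l₁ 0 0 * S l₂ 1 1 - S l₃ 0 1 * S l₃ 0 1) = max (v (S l₁ 0 0 * S l₂ 1 1)) (v (S l₃ 0 1 * S l₃ 0 1))) →
        ((Matrix.det (∑ l, ((X : F[X]) ^ d l) • (S l).map (C : F →+* F[X]))).support.filter fun E =>
            ∃ r : ℝ, 0 < r ∧ ∀ E' ∈ (Matrix.det (∑ l, ((X : F[X]) ^ d l) • (S l).map (C : F →+* F[X]))).support, E' ≠ E →
              v ((Matrix.det (∑ l, ((X : F[X]) ^ d l) • (S l).map (C : F →+* F[X]))).coeff E') * r ^ E'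
                < v ((Matrix.det (∑ l, ((X : F[X]) ^ d l) • (S l).map (C : F →+* F[X]))).coeff E) * r ^ E).card - 1
          ≤ 3 * K - 4 := by
  intro F _ v hv K d S hS hd hfree
  have hentry : ∀ i j : Fin 2, (∑ l, ((X : F[X]) ^ d l) • (S l).map (C : F →+* F[X])) i j = ∑ l, C (S l i j) * X ^ d l := by
    intro i j
    rw [Matrix.sum_apply]
    refine Finset.sum_congr rfl fun l _ => ?_
    rw [Matrix.smul_apply, Matrix.map_apply, smul_eq_mul, mul_comm]
  have hsym : ∀ l, S l 1 0 = S l 0 1 := fun l => (hS l).apply 0 1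
  rw [Matrix.det_fin_two, hentry, hentry, hentry, hentry]
  simp only [hsym]
  have h := card_dominant_symm_le v hv d hd (fun l => S l 0 0) (fun l => S l 0 1) (fun l => S l 1 1) hfree
  omega

/-- **SUPPORTS WITHOUT THREE-TERM PROGRESSIONS ⇒ THE SIDON ROW `npEdges ≤ 3K − 4` for valuatively nonsingular letters, UNFOLDED.**
If the support has no three-term progression (`d_{l₁} + d_{l₂} = 2 d_{l₃}` only for `l₁ = l₂ = l₃`; this forces injectivity) and each
symmetric letter's own determinant is cancellation-free (`v(a_l c_l − b_l²) = max(v(a_l c_l), v(b_l²))` — every letter of rank two «at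
its own scale»), then the determinant has at most `(2K − 3) + K` dominant exponents, whatever the four-term coincidences `d_x + d_y = d_z + d_w`
of the support — the Sidon hypothesis of ✓ `valSidonTwo_unfolded` is needed only on progressions. [corollary] -/
theorem valAPFreeSupport_unfolded :
    ∀ (F : Type) [Field F] (v : AbsoluteValue F ℝ), IsNonarchimedean v →
      ∀ (K : ℕ) (d : Fin K → ℕ) (S : Fin K → Matrix (Fin 2) (Fin 2) F), (∀ l, (S l).IsSymm) →
        (∀ l₁ l₂ l₃ : Fin K, d l₁ + d l₂ = d l₃ + d l₃ → l₁ = l₃ ∧ l₂ = l₃) →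
        (∀ l : Fin K, v (S l 0 0 * S l 1 1 - S l 0 1 * S l 0 1) = max (v (S l 0 0 * S l 1 1)) (v (S l 0 1 * S l 0 1))) →
        ((Matrix.det (∑ l, ((X : F[X]) ^ d l) • (S l).map (C : F →+* F[X]))).support.filter fun E =>
            ∃ r : ℝ, 0 < r ∧ ∀ E' ∈ (Matrix.det (∑ l, ((X : F[X]) ^ d l) • (S l).map (C : F →+* F[X]))).support, E' ≠ E →
              v ((Matrix.det (∑ l, ((X : F[X]) ^ d l) • (S l).map (C : F →+* F[X]))).coeff E') * r ^ E'
                < v ((Matrix.det (∑ l, ((X : F[X]) ^ d l) • (S l).map (C : F →+* F[X]))).coeff E) * r ^ E).card - 1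
          ≤ 3 * K - 4 := by
  intro F _ v hv K d S hS hap hns
  have hd : Function.Injective d := by
    intro l l' h
    exact (hap l l' l' (by rw [h])).1
  refine valProgressionFree_unfolded F v hv K d S hS hd fun l₁ l₂ l₃ h => ?_
  obtain ⟨h1, h2⟩ := hap l₁ l₂ l₃ h
  rw [h1, h2]
  exact hns l₃

end Summit.ValiantsHypothesis.ValiantsHypothesis.Theorems.KPlusLogSqLaw.ValDoor
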